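import Mathlib
import Summits.ValiantsHypothesis.ValiantsHypothesis.Theorems.LacunarySymmetroidMatrixDescartesCensusWindowFourPocketRows
import Summits.ValiantsHypothesis.ValiantsHypothesis.Theorems.LacunarySymmetroidMatrixDescartesCensusWindowFourPocketCalculus

/-!
# `MatrixDescartes` census — WINDOW-4 POCKET ROWS VI: the SECANT («xt-sec») rows — the pocket boundary is concave in slack coordinates

HONEST FRAMING.  Object-search cell `pub-symmetroid`, door-A target `DoorA26 := PosRootLawAt 2 6 19`
(stmt-ValiantsHypothesis-19979; OPEN, typed, never asserted).  Necessary-condition rows about the four-term WINDOWS of HYPOTHETICAL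
Descartes-sharp fewnomials; nothing here bounds any census count, kills any cell or bears on `MatrixDescartes`
(stmt-ValiantsHypothesis-18050) / `VP ≠ VNP`.

Along the lower branch the point `(σ2, σ1) = (L2(t), L1(t))` moves with `dσ1/dσ2 = L1′(t)/L2′(t) = t`, so `σ1` is a CONCAVE function
of `σ2` on the lower boundary of the three-root region (and symmetrically `σ2` of `σ1` on the upper boundary, slope `1/t`).  The kernel
form uses only the QUASI-CONCAVITY of `L1 − s·L2` (lower) / `L2 − s·L1` (upper) from `…CensusWindowFourPocketCalculus`:

* `fourNomial_lower_branch_bounds_log` / `fourNomial_upper_branch_bounds_log` — the branch bounds of `…PocketRows` in log form;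
* `fourNomial_pocket_secant_lower_of_three_le_countP` — lower-branch certificates `0 < t_hi ≤ t_lo ≤ t*` of the slab ends
  (`L2(t_lo) ≤ ℓlo`, `L2(t_hi) ≤ ℓhi`), an intercept `φlo ≤ L1(t_lo)`, a slope `0 ≤ s` with `φlo + s·(ℓhi − ℓlo) ≤ L1(t_hi)` (chord below
  the arc at both slab ends), and `ℓlo ≤ σ2 ≤ ℓhi` ⇒ `σ1 − s·σ2 ≥ φlo − s·ℓlo`;
* `fourNomial_pocket_secant_upper_of_three_le_countP` — the mirror statement on the upper branch (`σ2 − s·σ1 ≥ φlo − s·ℓlo` on a slab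
  `ℓlo ≤ σ1 ≤ ℓhi`);
* NUMERAL-FRIENDLY forms `fourNomial_pocket_secant_lower/upper_log_of_le`: slab ends `LO, HI`, intercepts `Flo, Fhi` through closed
  product facts (`H2(t_lo) ≤ LO`, `Fhi ≤ H1(t_hi)`, …), slope test `s·(log HI − log LO) ≤ log Fhi − log Flo` (log-linear in smooth numerals),
  slab from the node's branch facts — exactly the `xt-sec` row of engine-2 g34's `exacttubeq.py` with slope `s = p/q`.

With `…CensusWindowFourSharpBridge` everything applies verbatim to a window of a sharp fewnomial.  Related kernel work: the CHORD rows of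
the T4 instrument in coefficient coordinates, `…CensusTetranomialBranch/Chord` (val-sym-door-p4 g10, distinct-root currency).

[folklore] One-variable calculus; elementary.
-/

-- `Summit.ValiantsHypothesis.ValiantsHypothesis.…` repeats a component by the D-0017 layout
-- (single-conjunct summit), which the `dupNamespace` linter flags; the name is mandated.
set_option linter.dupNamespace false

namespace Summit.ValiantsHypothesis.ValiantsHypothesis.Theorems.LacunarySymmetroidMatrixDescartes.Census

open Polynomial Finset Set
open scoped BigOperators Polynomial

/-- **Lower-branch bounds, LOG form.**  Three positive roots with multiplicity (`a,b,c,e > 0`) give a lower-branch parameter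
`0 < t₁ ≤ t*` with `σ1 ≥ L1(t₁)` and `σ2 ≤ L2(t₁)`, where `σ1 = (u+v) log b − v log a − u log c`, `σ2 = (v+w) log c − w log b − v log e`,
`L1(t) = (u+v) log((u+v)+wt) − u log(u+(v+w)t) − v log v`, `L2(t) = (v+w) log(u+(v+w)t) − w log((u+v)+wt) − v log t − v log v`. [folklore] -/
theorem fourNomial_lower_branch_bounds_log {u v w : ℕ} (hu : 0 < u) (hv : 0 < v) (hw : 0 < w)
    {a b c e : ℝ} (ha : 0 < a) (hb : 0 < b) (hc : 0 < c) (he : 0 < e)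
    (h3 : 3 ≤ (C a - C b * X ^ u + C c * X ^ (u + v) - C e * X ^ (u + v + w) : ℝ[X]).roots.countP (fun x => 0 < x)) :
    ∃ t₁ : ℝ, 0 < t₁ ∧ (w : ℝ) * ((v : ℝ) + w) * t₁ ≤ (u : ℝ) * ((u : ℝ) + v) ∧
      ((u : ℝ) + v) * Real.log (((u : ℝ) + v) + (w : ℝ) * t₁) - (u : ℝ) * Real.log ((u : ℝ) + ((v : ℝ) + w) * t₁)
          - (v : ℝ) * Real.log (v : ℝ)
        ≤ ((u : ℝ) + v) * Real.log b - (v : ℝ) * Real.log a - (u : ℝ) * Real.log c ∧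
      ((v : ℝ) + w) * Real.log c - (w : ℝ) * Real.log b - (v : ℝ) * Real.log e
        ≤ ((v : ℝ) + w) * Real.log ((u : ℝ) + ((v : ℝ) + w) * t₁) - (w : ℝ) * Real.log (((u : ℝ) + v) + (w : ℝ) * t₁)
          - (v : ℝ) * Real.log t₁ - (v : ℝ) * Real.log (v : ℝ) := by
  obtain ⟨t₁, ht₁, hlow, h1, h2⟩ := fourNomial_lower_branch_bounds hu hv hw ha hc he (b := b) h3
  have hv0 : (0 : ℝ) < v := by exact_mod_cast hv
  have hA : 0 < ((u : ℝ) + v) + (w : ℝ) * t₁ := by positivity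
  have hB : 0 < (u : ℝ) + ((v : ℝ) + w) * t₁ := by positivity
  refine ⟨t₁, ht₁, hlow, ?_, ?_⟩
  · have hl := (Real.log_le_log_iff (by positivity) (by positivity)).mpr h1
    rw [log_pow_mul_pow_mul_pow ha hc hA, log_pow_mul_pow_mul_pow hb hv0 hB] at hl
    push_cast at hl
    linarith
  · have hl := (Real.log_le_log_iff (by positivity) (by positivity)).mpr h2
    have eL : Real.log (c ^ (v + w) * (v : ℝ) ^ v * ((((u : ℝ) + v) + (w : ℝ) * t₁) ^ w * t₁ ^ v))
        = ((v + w : ℕ) : ℝ) * Real.log c + (v : ℝ) * Real.log (v : ℝ)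
          + ((w : ℝ) * Real.log (((u : ℝ) + v) + (w : ℝ) * t₁) + (v : ℝ) * Real.log t₁) := by
      rw [Real.log_mul (by positivity) (by positivity), Real.log_mul (by positivity) (by positivity),
        Real.log_mul (by positivity) (by positivity), Real.log_pow, Real.log_pow, Real.log_pow, Real.log_pow]
    rw [eL, log_pow_mul_pow_mul_pow hb he hB] at hl
    push_cast at hl
    linarith

/-- **Upper-branch bounds, LOG form**: `t₂ ≥ t*` with `σ1 ≤ L1(t₂)` and `σ2 ≥ L2(t₂)`. [folklore] -/
theorem fourNomial_upper_branch_bounds_log {u v w : ℕ} (hu : 0 < u) (hv : 0 < v) (hw : 0 < w)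
    {a b c e : ℝ} (ha : 0 < a) (hb : 0 < b) (hc : 0 < c) (he : 0 < e)
    (h3 : 3 ≤ (C a - C b * X ^ u + C c * X ^ (u + v) - C e * X ^ (u + v + w) : ℝ[X]).roots.countP (fun x => 0 < x)) :
    ∃ t₂ : ℝ, 0 < t₂ ∧ (u : ℝ) * ((u : ℝ) + v) ≤ (w : ℝ) * ((v : ℝ) + w) * t₂ ∧
      ((u : ℝ) + v) * Real.log b - (v : ℝ) * Real.log a - (u : ℝ) * Real.log c
        ≤ ((u : ℝ) + v) * Real.log (((u : ℝ) + v) + (w : ℝ) * t₂) - (u : ℝ) * Real.log ((u : ℝ) + ((v : ℝ) + w) * t₂)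
          - (v : ℝ) * Real.log (v : ℝ) ∧
      ((v : ℝ) + w) * Real.log ((u : ℝ) + ((v : ℝ) + w) * t₂) - (w : ℝ) * Real.log (((u : ℝ) + v) + (w : ℝ) * t₂)
          - (v : ℝ) * Real.log t₂ - (v : ℝ) * Real.log (v : ℝ)
        ≤ ((v : ℝ) + w) * Real.log c - (w : ℝ) * Real.log b - (v : ℝ) * Real.log e := by
  obtain ⟨t₂, hup, h1, h2⟩ := fourNomial_upper_branch_bounds hu hv hw ha hb hc he h3
  have hv0 : (0 : ℝ) < v := by exact_mod_cast hv
  have ht₂ : 0 < t₂ := lt_of_lt_of_le (by positivity) ((div_le_iff₀ (by positivity)).mpr (by linarith [hup]) :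
    (u : ℝ) * ((u : ℝ) + v) / ((w : ℝ) * ((v : ℝ) + w)) ≤ t₂)
  have hA : 0 < ((u : ℝ) + v) + (w : ℝ) * t₂ := by positivity
  have hB : 0 < (u : ℝ) + ((v : ℝ) + w) * t₂ := by positivity
  refine ⟨t₂, ht₂, hup, ?_, ?_⟩
  · have hl := (Real.log_le_log_iff (by positivity) (by positivity)).mpr h1
    rw [log_pow_mul_pow_mul_pow ha hc hA, log_pow_mul_pow_mul_pow hb hv0 hB] at hl
    push_cast at hl
    linarith
  · have hl := (Real.log_le_log_iff (by positivity) (by positivity)).mpr h2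
    have eR : Real.log (c ^ (v + w) * (v : ℝ) ^ v * ((((u : ℝ) + v) + (w : ℝ) * t₂) ^ w * t₂ ^ v))
        = ((v + w : ℕ) : ℝ) * Real.log c + (v : ℝ) * Real.log (v : ℝ)
          + ((w : ℝ) * Real.log (((u : ℝ) + v) + (w : ℝ) * t₂) + (v : ℝ) * Real.log t₂) := by
      rw [Real.log_mul (by positivity) (by positivity), Real.log_mul (by positivity) (by positivity),
        Real.log_mul (by positivity) (by positivity), Real.log_pow, Real.log_pow, Real.log_pow, Real.log_pow]
    rw [eR, log_pow_mul_pow_mul_pow hb he hB] at hl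
    push_cast at hl
    linarith

/-- **SECANT ROW, LOWER BRANCH** (`exacttubeq`'s `xt-sec` row with `branch = 'lo'`) in LOG form.  Window `a − bX^u + cX^(u+v) − eX^S`
(`a,b,c,e > 0`, ≥ 3 positive roots with multiplicity), circuit logs `σ1 = (u+v) log b − v log a − u log c`,
`σ2 = (v+w) log c − w log b − v log e`; two LOWER-branch parameters `0 < t_hi ≤ t_lo ≤ t*` certifying the slab ends
(`L2(t_lo) ≤ ℓlo`, `L2(t_hi) ≤ ℓhi`), an intercept `φlo ≤ L1(t_lo)`, a slope `s ≥ 0` with `φlo + s·(ℓhi − ℓlo) ≤ L1(t_hi)` (the chord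
lies below the arc at both slab ends), and the slab `ℓlo ≤ σ2 ≤ ℓhi`.  Then `σ1 − s·σ2 ≥ φlo − s·ℓlo`.  (`L1 = log H1`, `L2 = log H2`;
the concavity of the branch enters only through the quasi-concavity of `L1 − s·L2`, `pocket_k_lower_ge_min`.) [folklore] -/
theorem fourNomial_pocket_secant_lower_of_three_le_countP {u v w : ℕ} (hu : 0 < u) (hv : 0 < v) (hw : 0 < w)
    {a b c e : ℝ} (ha : 0 < a) (hb : 0 < b) (hc : 0 < c) (he : 0 < e)
    (h3 : 3 ≤ (C a - C b * X ^ u + C c * X ^ (u + v) - C e * X ^ (u + v + w) : ℝ[X]).roots.countP (fun x => 0 < x))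
    {s tlo thi ℓlo ℓhi : ℝ} (hs : 0 ≤ s) (hthi : 0 < thi) (hth : thi ≤ tlo)
    (htlo : (w : ℝ) * ((v : ℝ) + w) * tlo ≤ (u : ℝ) * ((u : ℝ) + v))
    (hclo : (((v : ℝ) + w) * Real.log ((u : ℝ) + ((v : ℝ) + w) * tlo) - (w : ℝ) * Real.log (((u : ℝ) + v) + (w : ℝ) * tlo) - (v : ℝ) * Real.log tlo) - (v : ℝ) * Real.log (v : ℝ) ≤ ℓlo)
    (hchi : (((v : ℝ) + w) * Real.log ((u : ℝ) + ((v : ℝ) + w) * thi) - (w : ℝ) * Real.log (((u : ℝ) + v) + (w : ℝ) * thi) - (v : ℝ) * Real.log thi) - (v : ℝ) * Real.log (v : ℝ) ≤ ℓhi)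
    {φlo : ℝ} (hφ : φlo ≤ (((u : ℝ) + v) * Real.log (((u : ℝ) + v) + (w : ℝ) * tlo) - (u : ℝ) * Real.log ((u : ℝ) + ((v : ℝ) + w) * tlo)) - (v : ℝ) * Real.log (v : ℝ))
    (hslope : s * (ℓhi - ℓlo) ≤ ((((u : ℝ) + v) * Real.log (((u : ℝ) + v) + (w : ℝ) * thi) - (u : ℝ) * Real.log ((u : ℝ) + ((v : ℝ) + w) * thi)) - (v : ℝ) * Real.log (v : ℝ)) - φlo)
    (hσlo : ℓlo ≤ (((v : ℝ) + w) * Real.log c - (w : ℝ) * Real.log b - (v : ℝ) * Real.log e))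
    (hσhi : (((v : ℝ) + w) * Real.log c - (w : ℝ) * Real.log b - (v : ℝ) * Real.log e) ≤ ℓhi) :
    φlo - s * ℓlo
      ≤ (((u : ℝ) + v) * Real.log b - (v : ℝ) * Real.log a - (u : ℝ) * Real.log c)
        - s * (((v : ℝ) + w) * Real.log c - (w : ℝ) * Real.log b - (v : ℝ) * Real.log e) := by
  obtain ⟨t₁, ht₁, hlow₁, hP1, hP2⟩ := fourNomial_lower_branch_bounds_log hu hv hw ha hb hc he h3
  have hTle : ∀ {x : ℝ}, (w : ℝ) * ((v : ℝ) + w) * x ≤ (u : ℝ) * ((u : ℝ) + v) →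
      x ≤ (u : ℝ) * ((u : ℝ) + v) / ((w : ℝ) * ((v : ℝ) + w)) := by
    intro x hx; rw [le_div_iff₀ (by positivity)]; linarith
  -- `t₁ ≤ tlo`: otherwise `L2 t₁ < L2 tlo ≤ ℓlo ≤ σ2 ≤ L2 t₁`
  have ht₁lo : t₁ ≤ tlo := by
    by_contra hlt
    push Not at hlt
    have h : (((v : ℝ) + w) * Real.log ((u : ℝ) + ((v : ℝ) + w) * t₁) - (w : ℝ) * Real.log (((u : ℝ) + v) + (w : ℝ) * t₁) - (v : ℝ) * Real.log t₁)
        < (((v : ℝ) + w) * Real.log ((u : ℝ) + ((v : ℝ) + w) * tlo) - (w : ℝ) * Real.log (((u : ℝ) + v) + (w : ℝ) * tlo) - (v : ℝ) * Real.log tlo) :=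
      pocket_logH2_strictAntiOn hu hv hw ⟨hthi.trans_le hth, hTle htlo⟩ ⟨ht₁, hTle hlow₁⟩ hlt
    linarith
  have hsσ : s * (((v : ℝ) + w) * Real.log c - (w : ℝ) * Real.log b - (v : ℝ) * Real.log e) ≤ s * ℓhi :=
    mul_le_mul_of_nonneg_left hσhi hs
  have hslope' : s * ℓhi - s * ℓlo ≤ ((((u : ℝ) + v) * Real.log (((u : ℝ) + v) + (w : ℝ) * thi) - (u : ℝ) * Real.log ((u : ℝ) + ((v : ℝ) + w) * thi)) - (v : ℝ) * Real.log (v : ℝ)) - φlo := by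
    rw [← mul_sub]; exact hslope
  rcases le_or_gt thi t₁ with hcase | hcase
  · -- `thi ≤ t₁ ≤ tlo`: quasi-concavity of `k = L1 − s·L2`
    have hq := pocket_k_lower_ge_min (s := s) hu hv hw hthi hcase ht₁lo htlo
    have hsP2 : s * (((v : ℝ) + w) * Real.log c - (w : ℝ) * Real.log b - (v : ℝ) * Real.log e)
        ≤ s * (((v : ℝ) + w) * Real.log ((u : ℝ) + ((v : ℝ) + w) * t₁) - (w : ℝ) * Real.log (((u : ℝ) + v) + (w : ℝ) * t₁) - (v : ℝ) * Real.log t₁) - s * ((v : ℝ) * Real.log (v : ℝ)) := by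
      rw [← mul_sub]; exact mul_le_mul_of_nonneg_left hP2 hs
    have hshi : s * (((v : ℝ) + w) * Real.log ((u : ℝ) + ((v : ℝ) + w) * thi) - (w : ℝ) * Real.log (((u : ℝ) + v) + (w : ℝ) * thi) - (v : ℝ) * Real.log thi) - s * ((v : ℝ) * Real.log (v : ℝ)) ≤ s * ℓhi := by
      rw [← mul_sub]; exact mul_le_mul_of_nonneg_left hchi hs
    have hslo : s * (((v : ℝ) + w) * Real.log ((u : ℝ) + ((v : ℝ) + w) * tlo) - (w : ℝ) * Real.log (((u : ℝ) + v) + (w : ℝ) * tlo) - (v : ℝ) * Real.log tlo) - s * ((v : ℝ) * Real.log (v : ℝ)) ≤ s * ℓlo := by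
      rw [← mul_sub]; exact mul_le_mul_of_nonneg_left hclo hs
    rcases le_total ((((u : ℝ) + v) * Real.log (((u : ℝ) + v) + (w : ℝ) * thi) - (u : ℝ) * Real.log ((u : ℝ) + ((v : ℝ) + w) * thi))
        - s * (((v : ℝ) + w) * Real.log ((u : ℝ) + ((v : ℝ) + w) * thi) - (w : ℝ) * Real.log (((u : ℝ) + v) + (w : ℝ) * thi) - (v : ℝ) * Real.log thi))
      ((((u : ℝ) + v) * Real.log (((u : ℝ) + v) + (w : ℝ) * tlo) - (u : ℝ) * Real.log ((u : ℝ) + ((v : ℝ) + w) * tlo))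
        - s * (((v : ℝ) + w) * Real.log ((u : ℝ) + ((v : ℝ) + w) * tlo) - (w : ℝ) * Real.log (((u : ℝ) + v) + (w : ℝ) * tlo) - (v : ℝ) * Real.log tlo)) with hmin | hmin
    · rw [min_eq_left hmin] at hq
      linarith
    · rw [min_eq_right hmin] at hq
      linarith
  · -- `t₁ < thi`: `L1` strictly decreasing gives `σ1 ≥ L1 t₁ > L1 thi`
    have hthiT : (w : ℝ) * ((v : ℝ) + w) * thi ≤ (u : ℝ) * ((u : ℝ) + v) := by
      have : (0 : ℝ) ≤ (w : ℝ) * ((v : ℝ) + w) := by positivity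
      nlinarith [mul_le_mul_of_nonneg_left hth this]
    have h : (((u : ℝ) + v) * Real.log (((u : ℝ) + v) + (w : ℝ) * thi) - (u : ℝ) * Real.log ((u : ℝ) + ((v : ℝ) + w) * thi))
        < (((u : ℝ) + v) * Real.log (((u : ℝ) + v) + (w : ℝ) * t₁) - (u : ℝ) * Real.log ((u : ℝ) + ((v : ℝ) + w) * t₁)) :=
      pocket_logH1_strictAntiOn hu hv hw ⟨ht₁.le, hTle hlow₁⟩ ⟨hthi.le, hTle hthiT⟩ hcase
    linarith

/-- **SECANT ROW, UPPER BRANCH** (`exacttubeq`'s `xt-sec` row with `branch = 'up'`) in LOG form: two UPPER-branch parameters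
`t* ≤ t_lo ≤ t_hi` certifying the slab ends in the FIRST coordinate (`L1(t_lo) ≤ ℓlo`, `L1(t_hi) ≤ ℓhi`), an intercept `φlo ≤ L2(t_lo)`,
a slope `s ≥ 0` with `φlo + s·(ℓhi − ℓlo) ≤ L2(t_hi)`, and the slab `ℓlo ≤ σ1 ≤ ℓhi`.  Then `σ2 − s·σ1 ≥ φlo − s·ℓlo`. [folklore] -/
theorem fourNomial_pocket_secant_upper_of_three_le_countP {u v w : ℕ} (hu : 0 < u) (hv : 0 < v) (hw : 0 < w)
    {a b c e : ℝ} (ha : 0 < a) (hb : 0 < b) (hc : 0 < c) (he : 0 < e)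
    (h3 : 3 ≤ (C a - C b * X ^ u + C c * X ^ (u + v) - C e * X ^ (u + v + w) : ℝ[X]).roots.countP (fun x => 0 < x))
    {s tlo thi ℓlo ℓhi : ℝ} (hs : 0 ≤ s) (htlo : (u : ℝ) * ((u : ℝ) + v) ≤ (w : ℝ) * ((v : ℝ) + w) * tlo) (hth : tlo ≤ thi)
    (hclo : (((u : ℝ) + v) * Real.log (((u : ℝ) + v) + (w : ℝ) * tlo) - (u : ℝ) * Real.log ((u : ℝ) + ((v : ℝ) + w) * tlo)) - (v : ℝ) * Real.log (v : ℝ) ≤ ℓlo)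
    (hchi : (((u : ℝ) + v) * Real.log (((u : ℝ) + v) + (w : ℝ) * thi) - (u : ℝ) * Real.log ((u : ℝ) + ((v : ℝ) + w) * thi)) - (v : ℝ) * Real.log (v : ℝ) ≤ ℓhi)
    {φlo : ℝ} (hφ : φlo ≤ (((v : ℝ) + w) * Real.log ((u : ℝ) + ((v : ℝ) + w) * tlo) - (w : ℝ) * Real.log (((u : ℝ) + v) + (w : ℝ) * tlo) - (v : ℝ) * Real.log tlo) - (v : ℝ) * Real.log (v : ℝ))
    (hslope : s * (ℓhi - ℓlo) ≤ ((((v : ℝ) + w) * Real.log ((u : ℝ) + ((v : ℝ) + w) * thi) - (w : ℝ) * Real.log (((u : ℝ) + v) + (w : ℝ) * thi) - (v : ℝ) * Real.log thi) - (v : ℝ) * Real.log (v : ℝ)) - φlo)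
    (hσlo : ℓlo ≤ (((u : ℝ) + v) * Real.log b - (v : ℝ) * Real.log a - (u : ℝ) * Real.log c))
    (hσhi : (((u : ℝ) + v) * Real.log b - (v : ℝ) * Real.log a - (u : ℝ) * Real.log c) ≤ ℓhi) :
    φlo - s * ℓlo
      ≤ (((v : ℝ) + w) * Real.log c - (w : ℝ) * Real.log b - (v : ℝ) * Real.log e)
        - s * (((u : ℝ) + v) * Real.log b - (v : ℝ) * Real.log a - (u : ℝ) * Real.log c) := by
  obtain ⟨t₂, ht₂, hup₂, hP1, hP2⟩ := fourNomial_upper_branch_bounds_log hu hv hw ha hb hc he h3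
  have hTge : ∀ {x : ℝ}, (u : ℝ) * ((u : ℝ) + v) ≤ (w : ℝ) * ((v : ℝ) + w) * x →
      (u : ℝ) * ((u : ℝ) + v) / ((w : ℝ) * ((v : ℝ) + w)) ≤ x := by
    intro x hx; rw [div_le_iff₀ (by positivity)]; linarith
  -- `tlo ≤ t₂`: otherwise `L1 t₂ < L1 tlo ≤ ℓlo ≤ σ1 ≤ L1 t₂`
  have hlot₂ : tlo ≤ t₂ := by
    by_contra hlt
    push Not at hlt
    have h : (((u : ℝ) + v) * Real.log (((u : ℝ) + v) + (w : ℝ) * t₂) - (u : ℝ) * Real.log ((u : ℝ) + ((v : ℝ) + w) * t₂))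
        < (((u : ℝ) + v) * Real.log (((u : ℝ) + v) + (w : ℝ) * tlo) - (u : ℝ) * Real.log ((u : ℝ) + ((v : ℝ) + w) * tlo)) :=
      pocket_logH1_strictMonoOn hu hv hw (hTge hup₂) (hTge htlo) hlt
    linarith
  have hsσ : s * (((u : ℝ) + v) * Real.log b - (v : ℝ) * Real.log a - (u : ℝ) * Real.log c) ≤ s * ℓhi :=
    mul_le_mul_of_nonneg_left hσhi hs
  have hslope' : s * ℓhi - s * ℓlo ≤ ((((v : ℝ) + w) * Real.log ((u : ℝ) + ((v : ℝ) + w) * thi) - (w : ℝ) * Real.log (((u : ℝ) + v) + (w : ℝ) * thi) - (v : ℝ) * Real.log thi) - (v : ℝ) * Real.log (v : ℝ)) - φlo := by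
    rw [← mul_sub]; exact hslope
  rcases le_or_gt t₂ thi with hcase | hcase
  · -- `tlo ≤ t₂ ≤ thi`: quasi-concavity of `m = L2 − s·L1`
    have hq := pocket_m_upper_ge_min (s := s) hu hv hw hs htlo hlot₂ hcase
    have hsP1 : s * (((u : ℝ) + v) * Real.log b - (v : ℝ) * Real.log a - (u : ℝ) * Real.log c)
        ≤ s * (((u : ℝ) + v) * Real.log (((u : ℝ) + v) + (w : ℝ) * t₂) - (u : ℝ) * Real.log ((u : ℝ) + ((v : ℝ) + w) * t₂)) - s * ((v : ℝ) * Real.log (v : ℝ)) := by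
      rw [← mul_sub]; exact mul_le_mul_of_nonneg_left hP1 hs
    have hshi : s * (((u : ℝ) + v) * Real.log (((u : ℝ) + v) + (w : ℝ) * thi) - (u : ℝ) * Real.log ((u : ℝ) + ((v : ℝ) + w) * thi)) - s * ((v : ℝ) * Real.log (v : ℝ)) ≤ s * ℓhi := by
      rw [← mul_sub]; exact mul_le_mul_of_nonneg_left hchi hs
    have hslo : s * (((u : ℝ) + v) * Real.log (((u : ℝ) + v) + (w : ℝ) * tlo) - (u : ℝ) * Real.log ((u : ℝ) + ((v : ℝ) + w) * tlo)) - s * ((v : ℝ) * Real.log (v : ℝ)) ≤ s * ℓlo := by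
      rw [← mul_sub]; exact mul_le_mul_of_nonneg_left hclo hs
    rcases le_total ((((v : ℝ) + w) * Real.log ((u : ℝ) + ((v : ℝ) + w) * tlo) - (w : ℝ) * Real.log (((u : ℝ) + v) + (w : ℝ) * tlo) - (v : ℝ) * Real.log tlo)
        - s * (((u : ℝ) + v) * Real.log (((u : ℝ) + v) + (w : ℝ) * tlo) - (u : ℝ) * Real.log ((u : ℝ) + ((v : ℝ) + w) * tlo)))
      ((((v : ℝ) + w) * Real.log ((u : ℝ) + ((v : ℝ) + w) * thi) - (w : ℝ) * Real.log (((u : ℝ) + v) + (w : ℝ) * thi) - (v : ℝ) * Real.log thi)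
        - s * (((u : ℝ) + v) * Real.log (((u : ℝ) + v) + (w : ℝ) * thi) - (u : ℝ) * Real.log ((u : ℝ) + ((v : ℝ) + w) * thi))) with hmin | hmin
    · rw [min_eq_left hmin] at hq
      linarith
    · rw [min_eq_right hmin] at hq
      linarith
  · -- `thi < t₂`: `L2` strictly increasing gives `σ2 ≥ L2 t₂ > L2 thi`
    have h : (((v : ℝ) + w) * Real.log ((u : ℝ) + ((v : ℝ) + w) * thi) - (w : ℝ) * Real.log (((u : ℝ) + v) + (w : ℝ) * thi) - (v : ℝ) * Real.log thi)
        < (((v : ℝ) + w) * Real.log ((u : ℝ) + ((v : ℝ) + w) * t₂) - (w : ℝ) * Real.log (((u : ℝ) + v) + (w : ℝ) * t₂) - (v : ℝ) * Real.log t₂) :=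
      pocket_logH2_strictMonoOn hu hv hw (hTge (le_trans htlo (by
        have : (0 : ℝ) ≤ (w : ℝ) * ((v : ℝ) + w) := by positivity
        nlinarith [mul_le_mul_of_nonneg_left hth this]))) (hTge hup₂) hcase
    linarith

/-! ## NUMERAL-FRIENDLY secant rows: slab ends, chord intercepts and the slope test as closed facts about smooth rationals -/

/-- **Secant row, lower branch, numeral form.**  Lower-branch parameters `0 < t_hi ≤ t_lo ≤ t*`; positive rationals `LO, HI` (slab ends,
`H2(t_lo) ≤ LO`, `H2(t_hi) ≤ HI`) and `Flo, Fhi` (`Flo ≤ H1(t_lo)`, `Fhi ≤ H1(t_hi)`) as closed product facts; a slope `0 ≤ s` with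
`s·(log HI − log LO) ≤ log Fhi − log Flo`; the slab `log LO ≤ σ2 ≤ log HI`.  Then `σ1 − s·σ2 ≥ log Flo − s·log LO` — the `xt-sec`
row of `exacttubeq.py`. [folklore] -/
theorem fourNomial_pocket_secant_lower_log_of_le {u v w : ℕ} (hu : 0 < u) (hv : 0 < v) (hw : 0 < w)
    {a b c e : ℝ} (ha : 0 < a) (hb : 0 < b) (hc : 0 < c) (he : 0 < e)
    (h3 : 3 ≤ (C a - C b * X ^ u + C c * X ^ (u + v) - C e * X ^ (u + v + w) : ℝ[X]).roots.countP (fun x => 0 < x))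
    {s tlo thi LO HI Flo Fhi : ℝ} (hs : 0 ≤ s) (hthi : 0 < thi) (hth : thi ≤ tlo)
    (htlo : (w : ℝ) * ((v : ℝ) + w) * tlo ≤ (u : ℝ) * ((u : ℝ) + v))
    (hLO : 0 < LO) (hHI : 0 < HI) (hFlo : 0 < Flo) (hFhi : 0 < Fhi)
    (hLOt : ((u : ℝ) + ((v : ℝ) + w) * tlo) ^ (v + w) ≤ LO * ((v : ℝ) ^ v * ((((u : ℝ) + v) + (w : ℝ) * tlo) ^ w * tlo ^ v)))
    (hHIt : ((u : ℝ) + ((v : ℝ) + w) * thi) ^ (v + w) ≤ HI * ((v : ℝ) ^ v * ((((u : ℝ) + v) + (w : ℝ) * thi) ^ w * thi ^ v)))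
    (hFlot : Flo * ((v : ℝ) ^ v * ((u : ℝ) + ((v : ℝ) + w) * tlo) ^ u) ≤ (((u : ℝ) + v) + (w : ℝ) * tlo) ^ (u + v))
    (hFhit : Fhi * ((v : ℝ) ^ v * ((u : ℝ) + ((v : ℝ) + w) * thi) ^ u) ≤ (((u : ℝ) + v) + (w : ℝ) * thi) ^ (u + v))
    (hslope : s * (Real.log HI - Real.log LO) ≤ Real.log Fhi - Real.log Flo)
    (hσlo : Real.log LO ≤ (((v : ℝ) + w) * Real.log c - (w : ℝ) * Real.log b - (v : ℝ) * Real.log e))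
    (hσhi : (((v : ℝ) + w) * Real.log c - (w : ℝ) * Real.log b - (v : ℝ) * Real.log e) ≤ Real.log HI) :
    Real.log Flo - s * Real.log LO
      ≤ (((u : ℝ) + v) * Real.log b - (v : ℝ) * Real.log a - (u : ℝ) * Real.log c)
        - s * (((v : ℝ) + w) * Real.log c - (w : ℝ) * Real.log b - (v : ℝ) * Real.log e) := by
  have htlo0 : 0 < tlo := hthi.trans_le hth
  have h4 := pocket_le_logH1_of_prod (w := w) hu hv hthi hFhi hFhit
  exact fourNomial_pocket_secant_lower_of_three_le_countP hu hv hw ha hb hc he h3 hs hthi hth htlo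
    (pocket_logH2_le_of_prod hu hv htlo0 hLO hLOt) (pocket_logH2_le_of_prod hu hv hthi hHI hHIt)
    (pocket_le_logH1_of_prod (w := w) hu hv htlo0 hFlo hFlot) (by linarith) hσlo hσhi

/-- **Secant row, upper branch, numeral form.**  Upper-branch parameters `t* ≤ t_lo ≤ t_hi`; `H1(t_lo) ≤ LO`, `H1(t_hi) ≤ HI`,
`Flo ≤ H2(t_lo)`, `Fhi ≤ H2(t_hi)`; `0 ≤ s`, `s·(log HI − log LO) ≤ log Fhi − log Flo`; slab `log LO ≤ σ1 ≤ log HI`.  Then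
`σ2 − s·σ1 ≥ log Flo − s·log LO`. [folklore] -/
theorem fourNomial_pocket_secant_upper_log_of_le {u v w : ℕ} (hu : 0 < u) (hv : 0 < v) (hw : 0 < w)
    {a b c e : ℝ} (ha : 0 < a) (hb : 0 < b) (hc : 0 < c) (he : 0 < e)
    (h3 : 3 ≤ (C a - C b * X ^ u + C c * X ^ (u + v) - C e * X ^ (u + v + w) : ℝ[X]).roots.countP (fun x => 0 < x))
    {s tlo thi LO HI Flo Fhi : ℝ} (hs : 0 ≤ s) (htlo : (u : ℝ) * ((u : ℝ) + v) ≤ (w : ℝ) * ((v : ℝ) + w) * tlo) (hth : tlo ≤ thi)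
    (hLO : 0 < LO) (hHI : 0 < HI) (hFlo : 0 < Flo) (hFhi : 0 < Fhi)
    (hLOt : (((u : ℝ) + v) + (w : ℝ) * tlo) ^ (u + v) ≤ LO * ((v : ℝ) ^ v * ((u : ℝ) + ((v : ℝ) + w) * tlo) ^ u))
    (hHIt : (((u : ℝ) + v) + (w : ℝ) * thi) ^ (u + v) ≤ HI * ((v : ℝ) ^ v * ((u : ℝ) + ((v : ℝ) + w) * thi) ^ u))
    (hFlot : Flo * ((v : ℝ) ^ v * ((((u : ℝ) + v) + (w : ℝ) * tlo) ^ w * tlo ^ v)) ≤ ((u : ℝ) + ((v : ℝ) + w) * tlo) ^ (v + w))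
    (hFhit : Fhi * ((v : ℝ) ^ v * ((((u : ℝ) + v) + (w : ℝ) * thi) ^ w * thi ^ v)) ≤ ((u : ℝ) + ((v : ℝ) + w) * thi) ^ (v + w))
    (hslope : s * (Real.log HI - Real.log LO) ≤ Real.log Fhi - Real.log Flo)
    (hσlo : Real.log LO ≤ (((u : ℝ) + v) * Real.log b - (v : ℝ) * Real.log a - (u : ℝ) * Real.log c))
    (hσhi : (((u : ℝ) + v) * Real.log b - (v : ℝ) * Real.log a - (u : ℝ) * Real.log c) ≤ Real.log HI) :
    Real.log Flo - s * Real.log LO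
      ≤ (((v : ℝ) + w) * Real.log c - (w : ℝ) * Real.log b - (v : ℝ) * Real.log e)
        - s * (((u : ℝ) + v) * Real.log b - (v : ℝ) * Real.log a - (u : ℝ) * Real.log c) := by
  have htlo0 : 0 < tlo := lt_of_lt_of_le (by positivity) ((div_le_iff₀ (by positivity)).mpr (by linarith [htlo]) :
    (u : ℝ) * ((u : ℝ) + v) / ((w : ℝ) * ((v : ℝ) + w)) ≤ tlo)
  have hthi0 : 0 < thi := htlo0.trans_le hth
  have h4 := pocket_le_logH2_of_prod hu hv hthi0 hFhi hFhit
  exact fourNomial_pocket_secant_upper_of_three_le_countP hu hv hw ha hb hc he h3 hs htlo hth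
    (pocket_logH1_le_of_prod (w := w) hu hv htlo0 hLO hLOt) (pocket_logH1_le_of_prod (w := w) hu hv hthi0 hHI hHIt)
    (pocket_le_logH2_of_prod hu hv htlo0 hFlo hFlot) (by linarith) hσlo hσhi

end Summit.ValiantsHypothesis.ValiantsHypothesis.Theorems.LacunarySymmetroidMatrixDescartes.Census
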